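import Literature.IUT.HodgeTheaters.GoodLocalFrobenioidOfGaloisBaseRam
import Literature.IUT.HodgeTheaters.GoodLocalFrobenioidOfGaloisSplitFromFConj
import Literature.IUT.HodgeTheaters.InitialThetaDataLocalDeltaCharacteristic
import HarnessLib

/-!
# [IUTchI] Example 3.3 (iii) (d), (e) AT THE FINITE PLACE `v̲ = w ∣ p` of `K` (`K_v̲ := K_w`)

S. Mochizuki, *Inter-universal Teichmüller theory I*, §3, Example 3.3 (iii) (d), (e), kurims final manuscript (May
2020) p. 79 l. 43–62 [claim: Mochizuki2012, status: disputed], verbatim (our ellipses marked «[…]»; the cf-brackets sit in print's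
PREMISE sentences, the clauses (d), (e) themselves are bare): "Note that it follows immediately from the category-theoreticity
of the divisor monoid `Φ_{C_v}` [cf. [FrdI], Corollary 4.11, (iii); [FrdII], Theorem 1.2, (i)], together with (a), (c), and the
definition of `C⊢_v` [cf. also [AbsAnab], Proposition 1.2.1, (v)], that (d) `C⊢_v` may be reconstructed category-theoretically from
`F̲_v`.  Finally, by applying the algorithmically constructed field structure on the image of the Kummer map of [AbsTopIII],
Proposition 3.2, (iii) […], it follows that one may construct the element “`p_v`” of `O^▷_{K_v}` category-theoretically from `F̲_v`
[…]. […] In particular, (e) one may reconstruct the split Frobenioids `F⊢_v`, `F^Θ_v` category-theoretically from `F̲_v`."  Nothing of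
the series is asserted; no side is taken on [IUTchIII] Cor. 3.12.

PROOF-ONLY companion (abc-iut cell, seat abc-iut-w4-d047 gen 7; node IUTchI:Ex3.3(iii), rows E33iii/d, E33iii/e of
`plan/L5/SUBDAG-IUTchI-Ex33-Ex34.md`; director-abc g4-D7 «L5 HUB»), 0 definitions, no new Prop fact, nothing restated.
Clauses (a), (b), (c) of Ex. 3.3 (iii) already have kernel forms AT THE GENUINE PLACE `v̲ = w ∣ p` of the initial
Θ-datum (`ddashFromD_goodLocalFrobenioidAt_of_geomTFG` / `…_of_coinvariantRank`, `basesFromC_goodLocalFrobenioidAt`,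
`dFromF_goodLocalFrobenioidAt_of_geom_slim`), in which the density of `K` in `K_v̲` is a THEOREM
(`IsDedekindDomain.HeightOneSpectrum.denseRange_algebraMap`) and `K_v̲ := K_w` is abc-iut-S7's `RescaledCompletion K p w hw`.
Clauses (d) and (e) so far existed only over an ABSTRACT complete field `k ⊇ K` with the density `hd : DenseRange (K → k)`
displayed (abc-iut-L5-t16's `cdashFromF_goodLocalFrobenioidOfEmb`, `splitFromF_goodLocalFrobenioidOfEmb_of_conj_autCongr`;
abc-iut-f-052's regime variant `cdashFromF_goodLocalFrobenioidOfEmb_of_coinvariantRank`).  THIS FILE specialises them to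
the genuine place, DISCHARGING `hd` and (via FACT F-0240 `GeomTFG` BY NAME, `secondCountableTopology_PiC_of_geomTFG`) the
Galois-countability instance on `Π_{C_F}`:

* `cdashFromF_goodLocalFrobenioidAt` / `…_of_geomTFG` — (d) at `goodLocalFrobenioidAt w p hw hX` modulo
  {`hX` (Def. 3.1 (f)), `Δ_C` slim (FACT F-0004, first conjunct), [AbsAnab] Lem. 1.3.8 in the shape `hΔ` (FACT F-0007)}
  (+ F-0240 for the `_of_geomTFG` form, replacing the instance hypothesis);
* `cdashFromF_goodLocalFrobenioidAt_of_coinvariantRank` — (d) with `hΔ` REPLACED by print's regime input F-0001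
  `CoinvariantRankConstant` in unfolded shape at `Π_v̲` ([AbsTopI] Thm. 2.6 (ii));
* `splitFromF_goodLocalFrobenioidAt_of_conj_autCongr` / `…_of_geomTFG` — (e) at the place modulo
  {`hX`, F-0004, `hΔ` (F-0007 shape), (E2) in the conjugacy shape `hconj` over `G_{ℚ_p} := Aut_{ℚ_p-alg}(ℚ̄_p)`
  ([AbsTopIII] Thm. 1.9 / Cor. 1.10 (iii), Galois side, printed strength — GAP-LEDGER G-L5t16g8-1, a HYPOTHESIS)};
* `splitFromF_goodLocalFrobenioidAt_of_conj_autCongr_of_coinvariantRank` — (e) with `hΔ` replaced by the F-0001 regime.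

So at the genuine place every clause (a)–(e) of Ex. 3.3 (iii) is now a kernel theorem whose displayed inputs are ONLY
the datum's openness `hX`, frozen FACT-LIST rows by name / in printed shape (F-0240, F-0004, F-0007 or F-0001) and, for
(e), the one GAP-LEDGER hypothesis `hconj`.  typed ≠ proved for those inputs; «closed modulo (E2)» ≠ discharged.
-/

noncomputable section

namespace Literature.IUT.HodgeTheaters

open CategoryTheory Literature.AnabelianGeometry.SemiGraphs Literature.AlgebraicGeometry.Frobenioids
open Literature.AlgebraicGeometry.Frobenioids.PadicFrd Literature.AnabelianGeometry.AbsoluteAnabelian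
open Literature.NumberTheory.NumberFields IsDedekindDomain NumberField

universe u

section Place

variable {F : Type u} {K : Type} {Fbar : Type} [Field F] [NumberField F] [Field K] [NumberField K]
  [Algebra F K] [Field Fbar] [Algebra F Fbar] [Algebra K Fbar] [IsScalarTower F K Fbar] [Normal K Fbar]
  {E : WeierstrassCurve F} [E.IsElliptic] {l : ℕ} {Pb : BadPlacePredicates K}
  (D : InitialThetaData F K Fbar E l Pb) (w : HeightOneSpectrum (𝓞 K)) (p : ℕ) [Fact p.Prime]
  (hw : ((p : ℕ) : 𝓞 K) ∈ w.asIdeal)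

namespace InitialThetaData

/-! ### (d) `C⊢_v̲` from `F̲_v̲` at the place -/

/-- **[IUTchI] Ex. 3.3 (iii) (d) for `D` AT THE FINITE PLACE `v̲ = w ∣ p` of `K`** (`K_v̲ := K_w`, `Ω := K̄_w`,
`Π_v̲ := Π_{X̲→_K} ×_{G_K} Gal(K̄_w/K_w)` for the chosen embedding `F̄ → K̄_w`): `C⊢_v̲` is reconstructible from
`F̲_v̲ = C_v̲` at `goodLocalFrobenioidAt`, GIVEN the datum's openness `hX` (Def. 3.1 (f)), the Galois-countability of
`Π_{C_F}`, the slimness of `Δ_C` ([AbsAnab] Lem. 1.3.1, FACT F-0004 first conjunct) and [AbsAnab] Lem. 1.3.8 in the shape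
`hΔ` (FACT F-0007); the density of `K` in `K_w` is a theorem, the ramification clause is abc-iut-L5-t16's discharge.
([IUTchI] Ex 3.3 (iii) (d) p.79) [claim: Mochizuki2012, status: disputed] -/
theorem cdashFromF_goodLocalFrobenioidAt [SecondCountableTopology D.PiC]
    (hX : IsOpen (D.PiXarrow : Set D.PiC)) (hΔC : IsSlimGroup D.DeltaC)
    (hΔ : letI : Algebra K (RescaledCompletion K p w hw) := inferInstanceAs (Algebra K (w.adicCompletion K))
      ∀ φ : D.PiLoc D.PiXarrow (localToGF F (RescaledCompletion K p w hw)
          (localEmb (K := K) (Fbar := Fbar) (AlgebraicClosure (RescaledCompletion K p w hw)))) ≃ₜ*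
        D.PiLoc D.PiXarrow (localToGF F (RescaledCompletion K p w hw)
          (localEmb (K := K) (Fbar := Fbar) (AlgebraicClosure (RescaledCompletion K p w hw)))),
      (D.augLoc D.PiXarrow (localToGF F (RescaledCompletion K p w hw)
          (localEmb (K := K) (Fbar := Fbar) (AlgebraicClosure (RescaledCompletion K p w hw))))).ker.map
          φ.toMulEquiv.toMonoidHom =
        (D.augLoc D.PiXarrow (localToGF F (RescaledCompletion K p w hw)
          (localEmb (K := K) (Fbar := Fbar) (AlgebraicClosure (RescaledCompletion K p w hw))))).ker) :
    @GoodLocalFrobenioid.CdashFromF p (RescaledCompletion K p w hw) _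
      (GaloisValDatum.normVal (RescaledCompletion K p w hw)) (D.goodLocalFrobenioidAt w p hw hX) := by
  letI : Algebra K (RescaledCompletion K p w hw) := inferInstanceAs (Algebra K (w.adicCompletion K))
  haveI := GaloisValDatum.finiteDimensional_rescaledCompletion K p w hw
  exact D.cdashFromF_goodLocalFrobenioidOfEmb p (RescaledCompletion K p w hw)
    (localEmb (K := K) (Fbar := Fbar) (AlgebraicClosure (RescaledCompletion K p w hw))) hX
    (HeightOneSpectrum.denseRange_algebraMap K w) hΔC hΔ

/-- **(d) at the place `v̲ = w ∣ p`, the Galois-countability instance supplied by FACT F-0240 `GeomTFG` BY NAME**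
([AbsTopI] Prop. 2.2 ⇒ [IUTchI] Rmk. 2.5.3 (ii), `secondCountableTopology_PiC_of_geomTFG`): binders exactly
{F-0240, `hX`, F-0004 (first conjunct, tree shape `IsSlimGroup D.DeltaC`), F-0007 (shape `hΔ`)}.
([IUTchI] Ex 3.3 (iii) (d) p.79) [claim: Mochizuki2012, status: disputed] -/
theorem cdashFromF_goodLocalFrobenioidAt_of_geomTFG (hTFG : D.geom.extF.GeomTFG)
    (hX : IsOpen (D.PiXarrow : Set D.PiC)) (hΔC : IsSlimGroup D.DeltaC)
    (hΔ : letI : Algebra K (RescaledCompletion K p w hw) := inferInstanceAs (Algebra K (w.adicCompletion K))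
      ∀ φ : D.PiLoc D.PiXarrow (localToGF F (RescaledCompletion K p w hw)
          (localEmb (K := K) (Fbar := Fbar) (AlgebraicClosure (RescaledCompletion K p w hw)))) ≃ₜ*
        D.PiLoc D.PiXarrow (localToGF F (RescaledCompletion K p w hw)
          (localEmb (K := K) (Fbar := Fbar) (AlgebraicClosure (RescaledCompletion K p w hw)))),
      (D.augLoc D.PiXarrow (localToGF F (RescaledCompletion K p w hw)
          (localEmb (K := K) (Fbar := Fbar) (AlgebraicClosure (RescaledCompletion K p w hw))))).ker.map
          φ.toMulEquiv.toMonoidHom =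
        (D.augLoc D.PiXarrow (localToGF F (RescaledCompletion K p w hw)
          (localEmb (K := K) (Fbar := Fbar) (AlgebraicClosure (RescaledCompletion K p w hw))))).ker) :
    @GoodLocalFrobenioid.CdashFromF p (RescaledCompletion K p w hw) _
      (GaloisValDatum.normVal (RescaledCompletion K p w hw)) (D.goodLocalFrobenioidAt w p hw hX) :=
  haveI := D.secondCountableTopology_PiC_of_geomTFG hTFG
  D.cdashFromF_goodLocalFrobenioidAt w p hw hX hΔC hΔ

/-- **(d) at the place `v̲ = w ∣ p` with [AbsAnab] Lemma 1.3.8 REPLACED by print's regime input** — F-0001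
`CoinvariantRankConstant` in unfolded shape at `Π_v̲` ([AbsTopI] Thm. 2.6 (ii): `δ¹_l(P) − δ¹_l(aug P)` independent of `l`
for every open `P ⊆ Π_v̲`), through abc-iut-f-052's `cdashFromF_goodLocalFrobenioidOfEmb_of_coinvariantRank`; binders
exactly {F-0240, `hX`, F-0004 (first conjunct), F-0001 shape}. ([IUTchI] Ex 3.3 (iii) (d) p.79)
[claim: Mochizuki2012, status: disputed] -/
theorem cdashFromF_goodLocalFrobenioidAt_of_coinvariantRank (hTFG : D.geom.extF.GeomTFG)
    (hX : IsOpen (D.PiXarrow : Set D.PiC)) (hΔC : IsSlimGroup D.DeltaC)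
    (hc : letI : Algebra K (RescaledCompletion K p w hw) := inferInstanceAs (Algebra K (w.adicCompletion K))
      ∀ P : Subgroup (D.PiLoc D.PiXarrow (localToGF F (RescaledCompletion K p w hw)
          (localEmb (K := K) (Fbar := Fbar) (AlgebraicClosure (RescaledCompletion K p w hw))))),
      IsOpen (P : Set (D.PiLoc D.PiXarrow (localToGF F (RescaledCompletion K p w hw)
          (localEmb (K := K) (Fbar := Fbar) (AlgebraicClosure (RescaledCompletion K p w hw)))))) →
      ∀ (l₁ l₂ : ℕ) [Fact l₁.Prime] [Fact l₂.Prime],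
        freeProlRank P l₁ - freeProlRank (P.map (D.augLoc D.PiXarrow (localToGF F (RescaledCompletion K p w hw)
          (localEmb (K := K) (Fbar := Fbar) (AlgebraicClosure (RescaledCompletion K p w hw)))))) l₁ =
          freeProlRank P l₂ - freeProlRank (P.map (D.augLoc D.PiXarrow (localToGF F (RescaledCompletion K p w hw)
            (localEmb (K := K) (Fbar := Fbar) (AlgebraicClosure (RescaledCompletion K p w hw)))))) l₂) :
    @GoodLocalFrobenioid.CdashFromF p (RescaledCompletion K p w hw) _
      (GaloisValDatum.normVal (RescaledCompletion K p w hw)) (D.goodLocalFrobenioidAt w p hw hX) := by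
  letI : Algebra K (RescaledCompletion K p w hw) := inferInstanceAs (Algebra K (w.adicCompletion K))
  haveI := GaloisValDatum.finiteDimensional_rescaledCompletion K p w hw
  exact D.cdashFromF_goodLocalFrobenioidOfEmb_of_coinvariantRank p (RescaledCompletion K p w hw) hTFG
    (localEmb (K := K) (Fbar := Fbar) (AlgebraicClosure (RescaledCompletion K p w hw))) hX
    (HeightOneSpectrum.denseRange_algebraMap K w) hΔC hc

/-! ### (e) `F⊢_v̲`, `F^Θ_v̲` from `F̲_v̲` at the place, modulo (E2) in conjugacy shape -/

/-- **[IUTchI] Ex. 3.3 (iii) (e) for `D` AT THE FINITE PLACE `v̲ = w ∣ p` of `K`**, modulo the anabelian input (E2)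
in the CONJUGACY SHAPE over `G_{ℚ_p} := Aut_{ℚ_p-alg}(AlgebraicClosure ℚ_[p])` after transport along any `ℚ_p`-algebra
isomorphism `e : K̄_w ≃ ℚ̄_p` ([AbsTopIII] Thm. 1.9 / Cor. 1.10 (iii), Galois side, printed strength; GAP-LEDGER
G-L5t16g8-1 — a HYPOTHESIS `hconj`), the datum's openness `hX`, the Galois-countability of `Π_{C_F}`, F-0004 (first
conjunct) and F-0007 (shape `hΔ`): the split Frobenioids `F⊢_v̲`, `F^Θ_v̲` are reconstructible from `F̲_v̲ = C_v̲` at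
`goodLocalFrobenioidAt` (abc-iut-L5-t16's `splitFromF_goodLocalFrobenioidOfEmb_of_conj_autCongr` with the density of `K`
in `K_w` DISCHARGED). ([IUTchI] Ex 3.3 (iii) (e) p.79) [claim: Mochizuki2012, status: disputed] -/
theorem splitFromF_goodLocalFrobenioidAt_of_conj_autCongr [SecondCountableTopology D.PiC]
    (hX : IsOpen (D.PiXarrow : Set D.PiC)) (hΔC : IsSlimGroup D.DeltaC)
    (hΔ : letI : Algebra K (RescaledCompletion K p w hw) := inferInstanceAs (Algebra K (w.adicCompletion K))
      ∀ φ : D.PiLoc D.PiXarrow (localToGF F (RescaledCompletion K p w hw)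
          (localEmb (K := K) (Fbar := Fbar) (AlgebraicClosure (RescaledCompletion K p w hw)))) ≃ₜ*
        D.PiLoc D.PiXarrow (localToGF F (RescaledCompletion K p w hw)
          (localEmb (K := K) (Fbar := Fbar) (AlgebraicClosure (RescaledCompletion K p w hw)))),
      (D.augLoc D.PiXarrow (localToGF F (RescaledCompletion K p w hw)
          (localEmb (K := K) (Fbar := Fbar) (AlgebraicClosure (RescaledCompletion K p w hw))))).ker.map
          φ.toMulEquiv.toMonoidHom =
        (D.augLoc D.PiXarrow (localToGF F (RescaledCompletion K p w hw)
          (localEmb (K := K) (Fbar := Fbar) (AlgebraicClosure (RescaledCompletion K p w hw))))).ker)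
    (e : letI : Algebra K (RescaledCompletion K p w hw) := inferInstanceAs (Algebra K (w.adicCompletion K))
      AlgebraicClosure (RescaledCompletion K p w hw) ≃ₐ[ℚ_[p]] PadicAlgCl p)
    (hconj : letI : Algebra K (RescaledCompletion K p w hw) := inferInstanceAs (Algebra K (w.adicCompletion K))
      ∀ φ : D.PiLoc D.PiXarrow (localToGF F (RescaledCompletion K p w hw)
          (localEmb (K := K) (Fbar := Fbar) (AlgebraicClosure (RescaledCompletion K p w hw)))) ≃ₜ*
        D.PiLoc D.PiXarrow (localToGF F (RescaledCompletion K p w hw)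
          (localEmb (K := K) (Fbar := Fbar) (AlgebraicClosure (RescaledCompletion K p w hw)))),
      ∃ τ : PadicAlgCl p ≃ₐ[ℚ_[p]] PadicAlgCl p,
        ∀ g : D.PiLoc D.PiXarrow (localToGF F (RescaledCompletion K p w hw)
          (localEmb (K := K) (Fbar := Fbar) (AlgebraicClosure (RescaledCompletion K p w hw)))),
        e.autCongr (AlgEquiv.restrictScalars ℚ_[p] (D.augLoc D.PiXarrow (localToGF F (RescaledCompletion K p w hw)
            (localEmb (K := K) (Fbar := Fbar) (AlgebraicClosure (RescaledCompletion K p w hw)))) (φ g))) =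
          τ * e.autCongr (AlgEquiv.restrictScalars ℚ_[p] (D.augLoc D.PiXarrow (localToGF F (RescaledCompletion K p w hw)
            (localEmb (K := K) (Fbar := Fbar) (AlgebraicClosure (RescaledCompletion K p w hw)))) g)) * τ⁻¹) :
    @GoodLocalFrobenioid.SplitFromF p (RescaledCompletion K p w hw) _
      (GaloisValDatum.normVal (RescaledCompletion K p w hw)) (D.goodLocalFrobenioidAt w p hw hX) := by
  letI : Algebra K (RescaledCompletion K p w hw) := inferInstanceAs (Algebra K (w.adicCompletion K))
  haveI := GaloisValDatum.finiteDimensional_rescaledCompletion K p w hw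
  exact D.splitFromF_goodLocalFrobenioidOfEmb_of_conj_autCongr p (RescaledCompletion K p w hw)
    (localEmb (K := K) (Fbar := Fbar) (AlgebraicClosure (RescaledCompletion K p w hw))) hX
    (HeightOneSpectrum.denseRange_algebraMap K w) hΔC hΔ e hconj

/-- **(e) at the place `v̲ = w ∣ p`, the Galois-countability instance supplied by FACT F-0240 `GeomTFG` BY NAME**:
binders exactly {F-0240, `hX`, F-0004 (first conjunct), F-0007 (shape `hΔ`), `hconj` (G-L5t16g8-1)}.
([IUTchI] Ex 3.3 (iii) (e) p.79) [claim: Mochizuki2012, status: disputed] -/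
theorem splitFromF_goodLocalFrobenioidAt_of_conj_autCongr_of_geomTFG (hTFG : D.geom.extF.GeomTFG)
    (hX : IsOpen (D.PiXarrow : Set D.PiC)) (hΔC : IsSlimGroup D.DeltaC)
    (hΔ : letI : Algebra K (RescaledCompletion K p w hw) := inferInstanceAs (Algebra K (w.adicCompletion K))
      ∀ φ : D.PiLoc D.PiXarrow (localToGF F (RescaledCompletion K p w hw)
          (localEmb (K := K) (Fbar := Fbar) (AlgebraicClosure (RescaledCompletion K p w hw)))) ≃ₜ*
        D.PiLoc D.PiXarrow (localToGF F (RescaledCompletion K p w hw)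
          (localEmb (K := K) (Fbar := Fbar) (AlgebraicClosure (RescaledCompletion K p w hw)))),
      (D.augLoc D.PiXarrow (localToGF F (RescaledCompletion K p w hw)
          (localEmb (K := K) (Fbar := Fbar) (AlgebraicClosure (RescaledCompletion K p w hw))))).ker.map
          φ.toMulEquiv.toMonoidHom =
        (D.augLoc D.PiXarrow (localToGF F (RescaledCompletion K p w hw)
          (localEmb (K := K) (Fbar := Fbar) (AlgebraicClosure (RescaledCompletion K p w hw))))).ker)
    (e : letI : Algebra K (RescaledCompletion K p w hw) := inferInstanceAs (Algebra K (w.adicCompletion K))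
      AlgebraicClosure (RescaledCompletion K p w hw) ≃ₐ[ℚ_[p]] PadicAlgCl p)
    (hconj : letI : Algebra K (RescaledCompletion K p w hw) := inferInstanceAs (Algebra K (w.adicCompletion K))
      ∀ φ : D.PiLoc D.PiXarrow (localToGF F (RescaledCompletion K p w hw)
          (localEmb (K := K) (Fbar := Fbar) (AlgebraicClosure (RescaledCompletion K p w hw)))) ≃ₜ*
        D.PiLoc D.PiXarrow (localToGF F (RescaledCompletion K p w hw)
          (localEmb (K := K) (Fbar := Fbar) (AlgebraicClosure (RescaledCompletion K p w hw)))),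
      ∃ τ : PadicAlgCl p ≃ₐ[ℚ_[p]] PadicAlgCl p,
        ∀ g : D.PiLoc D.PiXarrow (localToGF F (RescaledCompletion K p w hw)
          (localEmb (K := K) (Fbar := Fbar) (AlgebraicClosure (RescaledCompletion K p w hw)))),
        e.autCongr (AlgEquiv.restrictScalars ℚ_[p] (D.augLoc D.PiXarrow (localToGF F (RescaledCompletion K p w hw)
            (localEmb (K := K) (Fbar := Fbar) (AlgebraicClosure (RescaledCompletion K p w hw)))) (φ g))) =
          τ * e.autCongr (AlgEquiv.restrictScalars ℚ_[p] (D.augLoc D.PiXarrow (localToGF F (RescaledCompletion K p w hw)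
            (localEmb (K := K) (Fbar := Fbar) (AlgebraicClosure (RescaledCompletion K p w hw)))) g)) * τ⁻¹) :
    @GoodLocalFrobenioid.SplitFromF p (RescaledCompletion K p w hw) _
      (GaloisValDatum.normVal (RescaledCompletion K p w hw)) (D.goodLocalFrobenioidAt w p hw hX) :=
  haveI := D.secondCountableTopology_PiC_of_geomTFG hTFG
  D.splitFromF_goodLocalFrobenioidAt_of_conj_autCongr w p hw hX hΔC hΔ e hconj

/-- **(e) at the place `v̲ = w ∣ p` with [AbsAnab] Lemma 1.3.8 REPLACED by the F-0001 regime** ([AbsTopI] Thm. 2.6 (ii)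
in unfolded shape at `Π_v̲`, through abc-iut-f-052's `forall_map_ker_augLoc_of_coinvariantRank`): binders exactly
{F-0240, `hX`, F-0004 (first conjunct), F-0001 shape, `hconj` (G-L5t16g8-1)}. ([IUTchI] Ex 3.3 (iii) (e) p.79)
[claim: Mochizuki2012, status: disputed] -/
theorem splitFromF_goodLocalFrobenioidAt_of_conj_autCongr_of_coinvariantRank (hTFG : D.geom.extF.GeomTFG)
    (hX : IsOpen (D.PiXarrow : Set D.PiC)) (hΔC : IsSlimGroup D.DeltaC)
    (hc : letI : Algebra K (RescaledCompletion K p w hw) := inferInstanceAs (Algebra K (w.adicCompletion K))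
      ∀ P : Subgroup (D.PiLoc D.PiXarrow (localToGF F (RescaledCompletion K p w hw)
          (localEmb (K := K) (Fbar := Fbar) (AlgebraicClosure (RescaledCompletion K p w hw))))),
      IsOpen (P : Set (D.PiLoc D.PiXarrow (localToGF F (RescaledCompletion K p w hw)
          (localEmb (K := K) (Fbar := Fbar) (AlgebraicClosure (RescaledCompletion K p w hw)))))) →
      ∀ (l₁ l₂ : ℕ) [Fact l₁.Prime] [Fact l₂.Prime],
        freeProlRank P l₁ - freeProlRank (P.map (D.augLoc D.PiXarrow (localToGF F (RescaledCompletion K p w hw)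
          (localEmb (K := K) (Fbar := Fbar) (AlgebraicClosure (RescaledCompletion K p w hw)))))) l₁ =
          freeProlRank P l₂ - freeProlRank (P.map (D.augLoc D.PiXarrow (localToGF F (RescaledCompletion K p w hw)
            (localEmb (K := K) (Fbar := Fbar) (AlgebraicClosure (RescaledCompletion K p w hw)))))) l₂)
    (e : letI : Algebra K (RescaledCompletion K p w hw) := inferInstanceAs (Algebra K (w.adicCompletion K))
      AlgebraicClosure (RescaledCompletion K p w hw) ≃ₐ[ℚ_[p]] PadicAlgCl p)
    (hconj : letI : Algebra K (RescaledCompletion K p w hw) := inferInstanceAs (Algebra K (w.adicCompletion K))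
      ∀ φ : D.PiLoc D.PiXarrow (localToGF F (RescaledCompletion K p w hw)
          (localEmb (K := K) (Fbar := Fbar) (AlgebraicClosure (RescaledCompletion K p w hw)))) ≃ₜ*
        D.PiLoc D.PiXarrow (localToGF F (RescaledCompletion K p w hw)
          (localEmb (K := K) (Fbar := Fbar) (AlgebraicClosure (RescaledCompletion K p w hw)))),
      ∃ τ : PadicAlgCl p ≃ₐ[ℚ_[p]] PadicAlgCl p,
        ∀ g : D.PiLoc D.PiXarrow (localToGF F (RescaledCompletion K p w hw)
          (localEmb (K := K) (Fbar := Fbar) (AlgebraicClosure (RescaledCompletion K p w hw)))),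
        e.autCongr (AlgEquiv.restrictScalars ℚ_[p] (D.augLoc D.PiXarrow (localToGF F (RescaledCompletion K p w hw)
            (localEmb (K := K) (Fbar := Fbar) (AlgebraicClosure (RescaledCompletion K p w hw)))) (φ g))) =
          τ * e.autCongr (AlgEquiv.restrictScalars ℚ_[p] (D.augLoc D.PiXarrow (localToGF F (RescaledCompletion K p w hw)
            (localEmb (K := K) (Fbar := Fbar) (AlgebraicClosure (RescaledCompletion K p w hw)))) g)) * τ⁻¹) :
    @GoodLocalFrobenioid.SplitFromF p (RescaledCompletion K p w hw) _
      (GaloisValDatum.normVal (RescaledCompletion K p w hw)) (D.goodLocalFrobenioidAt w p hw hX) := by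
  letI : Algebra K (RescaledCompletion K p w hw) := inferInstanceAs (Algebra K (w.adicCompletion K))
  haveI := GaloisValDatum.finiteDimensional_rescaledCompletion K p w hw
  haveI := D.secondCountableTopology_PiC_of_geomTFG hTFG
  exact D.splitFromF_goodLocalFrobenioidAt_of_conj_autCongr w p hw hX hΔC
    (D.forall_map_ker_augLoc_of_coinvariantRank p (RescaledCompletion K p w hw)
      (localEmb (K := K) (Fbar := Fbar) (AlgebraicClosure (RescaledCompletion K p w hw))) hTFG hX hc) e hconj

end InitialThetaData

end Place

end Literature.IUT.HodgeTheaters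

end
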